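import Summits.CriticalPhenomena.PercolationContinuityZ3.Theorems.PercNearOneGluingNoHeavyLowerTailMajorityGluingTypeTableFixedMCellDefs
import HarnessLib

/-!
# Template S (the scaled conic programme of THEOREM BOTTOM-3) in the kernel — definitions and the checks
(lane prim-rate, constants-miner 1, gen 30; KERNEL-WINDOW.md §0 (5)(i), §3 item 3; RIGOROUS-CERTIFICATION.md §4; census/g25/DERIVATIONS.md)

Support file for the closed crux `NoHeavyLowerTail` (stmt-CriticalPhenomena-4575), majority-gluing line; continuation of
`…TypeTableFixedMGrid` / `…TypeTableFixedMCellDefs` (template B data: `TRow`, `PKind`, the grid brackets, `powUp`, `sig4φ`).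
THE ASYMPTOTIC BOTTOM of the weak `(4,3)` cell: for a law `x` of the symmetric programme with the `O`-rows at a hub weight
`0 < M ≤ M_top = 2^{-K/32}` the SCALED law `x̂ = (M_top/M)^{s₀}·x`, `s₀ = κ₀/(2−4p)` (`p = 1/c₄`, `κ₀ = 4p − 1`), satisfies a CONE
of rows whose constants do not depend on `M` (THEOREM BOTTOM-3's `μ ≡ 1` scaling): the 49 linear rows, `E ≥ 0`, dominance
`T̂_z ≤ T̂_w` of the largest layer, the richness bands `(1+r_lo)T̂_z ≤ Ŝ_z ≤ (1+r_hi)T̂_z` of a band pattern, junk / control /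
relay-root consequences, template B's ISO tangents at grid index `K` (the support bounds `ρ₀ ≤ 1`, `ρ_f ≤ 2`, … hold for `x`
and the scaling exponents have the right sign), the sqrt-STAR cuts `T̂_z ≤ (M_top^{κ₀}/θ_z)^{1/2}(Σ̂₄/4)^{2p}` and the STAR-B cuts
`T̂_z ≤ (c_w M_top^{κ₀}/θ)^{1/(2−p)}(Σ̂₃/3)^{3p/(2−p)}`; in WORLD B (dominant relay in the lowest band) the variables are restricted to
`SMALL_w` (`large`).  A certificate bounds a degree-1 concave objective (`GM4 = (Π_z(Ŝ_z+T̂_z))^{1/4}`, `GM3`, or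
`(ρ̂_aρ̂_bρ̂_c)^{1/3}`) by `V/N_obj` through an exactly dual-feasible cone certificate (`checkCone`: residuals `≤ 0` on the support,
no variable bounds) whose box rows `x̂_τ ≤ BOX` are removed by a star-shapedness argument (`V < E1·BOX`); the closing checks
`closeA/closeB/close8` (pure `ℚ`) turn the objective bound into `E ≤ M` for EVERY `M ≤ M_top`.  This file: the data
(`linOrd`, `large`, bands, `SRow`, `SObj`, `SCert`, `CEntry`), the new rational constants (`CuS`, `CBU240`, `ZL/ZU`, `EBL/EBU`,
`CWU`, `RAU`, `R8U`), and the checks `SRow.ok`, `checkCone`, `checkS`, `closeA/B/8`, `caseCheck`.  Soundness is the business of the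
`…TypeTableScaled{Cone,Law,Iso,Star,Sound}` files.  Definitions only; no percolation, no sorries.
[cite: VandenbergHaggstromKahn2005, Thm. 1.3 (p. 6)]
-/

namespace Summit.CriticalPhenomena.PercolationContinuityZ3.Theorems

namespace HubOnly
namespace TypeTable

open DType

/-! ### The `O`-rows, the large types of world B, the band table -/

/-- The 27 ordered-pair `O`-row functionals (WLOG order `δ₂ ≥ δ₃ ≥ δ₄` of the relay hub weights): for each pair
`(x,y) ∈ {(2,3),(2,4),(3,4)}` the rows `O_tot, O_alone, O_dnboth, O_upany, O_upboth, O_dn r₀, O_dn r₁, O_up r₀, O_up r₁`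
(`(r₀,r₁)` = the two other relays, `v₁` first); each row is `lin φ x ≤ 0`. -/
def linOrd : List (DType → ℤ) :=
  [fun τ => τ.od 2 3, fun τ => τ.oalone 2 3, fun τ => τ.odnboth 2 3, fun τ => τ.oupany 2 3, fun τ => τ.oupboth 2 3,
   fun τ => τ.odn 1 2 3, fun τ => τ.odn 4 2 3, fun τ => τ.oup 1 2 3, fun τ => τ.oup 4 2 3, fun τ => τ.od 2 4,
   fun τ => τ.oalone 2 4, fun τ => τ.odnboth 2 4, fun τ => τ.oupany 2 4, fun τ => τ.oupboth 2 4, fun τ => τ.odn 1 2 4,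
   fun τ => τ.odn 3 2 4, fun τ => τ.oup 1 2 4, fun τ => τ.oup 3 2 4, fun τ => τ.od 3 4, fun τ => τ.oalone 3 4,
   fun τ => τ.odnboth 3 4, fun τ => τ.oupany 3 4, fun τ => τ.oupboth 3 4, fun τ => τ.odn 1 3 4, fun τ => τ.odn 2 3 4,
   fun τ => τ.oup 1 3 4, fun τ => τ.oup 2 3 4]

/-- All 49 linear rows: the 22 `O`-free rows of `linFree`, then the 27 `O`-rows. -/
def linAll : List (DType → ℤ) := linFree ++ linOrd

namespace DType

/-- The LARGE types of world B with dominant relay `w` (their scaled mass is not controlled): `K4`, the family type `t_w`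
(`v_w` the only attached relay, the other three in one cut block), and the five types whose only cut relay is `v_w`. -/
def large (w : ℕ) (τ : DType) : Bool := τ.isK4 || τ.isLt w || (τ.cut w && τ.ncut == 1)

end DType

/-- The column set `P` that carries the box rows and the `ε`-part of the objective: the non-inert types other than `K4`,
and in world B (restricted) moreover outside `LARGE_w` and other than `q_w` (a zero column there). -/
def pcol (restricted : Bool) (w : ℕ) (τ : DType) : Bool :=
  !τ.inert && !τ.isK4 && (!restricted || (!τ.large w && !τ.isLq w))

/-- The support of the (restricted) scaled law: every type in world A, the complement of `LARGE_w` in world B. -/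
def vset (restricted : Bool) (w : ℕ) (τ : DType) : Bool := !restricted || !τ.large w

/-- A richness band `[lo, hi]` for `r_z = S_z/T_z − 1` (`hi = none`: unbounded), with the dyadic code `t` of `θ = 1 − hi = 2^{-t}`
when `θ > 0` (the sqrt-STAR / STAR-B rows need `θ^{-1/2}`, `θ^{-1/(2-p)}`). -/
structure Band where
  /-- lower edge `r_lo` (`-1` = none) -/
  lo : ℚ
  /-- upper edge `r_hi` -/
  hi : Option ℚ
  /-- `θ = 2^{-t}` -/
  tcode : Option ℕ

/-- THE BAND TABLE: `[−1, 1/2]` (`θ = 1/2`), `[1/2, 1]` (`θ = 0`), `[1, ∞)` (rich). -/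
def BANDS : List Band := [⟨-1, some (1 / 2), some 1⟩, ⟨1 / 2, some 1, none⟩, ⟨1, none, none⟩]

/-- Band of index `b` (default: rich). -/
def band (b : ℕ) : Band := BANDS.getD b ⟨1, none, none⟩

/-- A CASE of the scaled programme: the dominant relay `w` and the band index of each relay (`pat = [b₁, b₂, b₃, b₄]`). -/
structure SCase where
  /-- the dominant relay (`T_z ≤ T_w` for all `z`) -/
  w : ℕ
  /-- band indices of the relays `1, 2, 3, 4` -/
  pat : List ℕ

/-- The band of relay `z` in the case. -/
def SCase.bandOf (cs : SCase) (z : ℕ) : Band := band (cs.pat.getD (z - 1) 2)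

/-! ### New rational constants -/

/-- Upper bound of the sqrt-STAR constant `θ^{-1/2}·M_top^{κ₀/2}·4^{-2p}` for `θ = 2^{-t}`, `M_top = 2^{-K/32}` (`K` even):
`η^{16t}·θ₄^{-2K-128}·η^{K/2}` (`κ₀/2 = 2p − 1/2`). -/
def CuS (K t : ℕ) : ℚ :=
  powUp ETAL ETAU (16 * (t : ℤ)) * powUp TH4L TH4U (-(2 * (K : ℤ)) - 128) * powUp ETAL ETAU ((K / 2 : ℕ) : ℤ)

/-- Lower / upper brackets of `e_B = 3p/(2−p) = 3/(2c₄−1) = 0.766312060385…` (the STAR-B support exponent). -/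
def EBL : ℚ := 766312060385 / 10 ^ 12
/-- see `EBL` -/
def EBU : ℚ := 766312060386 / 10 ^ 12
/-- Brackets of `ζ = 2^{e_B/32}` (STAR-B support powers on the grid: `(2^{i/32})^{e_B} = ζ^i`). -/
def ZL : ℚ := 10167374947524 / 10 ^ 13
/-- see `ZL` -/
def ZU : ℚ := 10167375057212 / 10 ^ 13

/-- Upper bounds of `c_w = (2 + r_hi(w))^{p}` (times `1 + 10⁻⁵`) for the upper band edges `r_hi ∈ {1/2, 1}` of the table. -/
def CWU (h : ℚ) : Option ℚ :=
  if h = 1 / 2 then some (1451904124621 / 10 ^ 12) else if h = 1 then some (1563720527248 / 10 ^ 12) else none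

/-- Upper bounds of the STAR-B constant `C_B = ((2+r_hi)^{p}/θ)^{1/(2−p)}·3^{−e_B}·M_top^{κ₀/(2−p)}` at `K = 240`, `θ = 2^{-t}`,
for `r_hi ∈ {1/2, 1}` and `t ∈ {1, 2}` (times `1 + 10⁻⁵`; certified in `…TypeTableScaledStarCert`). -/
def CBU240 (h : ℚ) (t : ℕ) : Option ℚ :=
  if h = 1 / 2 ∧ t = 1 then some (108487182711 / 10 ^ 12) else if h = 1 / 2 ∧ t = 2 then some (167625691230 / 10 ^ 12)
  else if h = 1 ∧ t = 1 then some (113659117363 / 10 ^ 12) else if h = 1 ∧ t = 2 then some (175616949732 / 10 ^ 12) else none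

/-- Upper bound of `M_top^{κ₀−1} = 2^{K(2−4p)/32} = η^{2K}θ₄^{−4K}`. -/
def RAU (K : ℕ) : ℚ := powUp ETAL ETAU (2 * (K : ℤ)) * powUp TH4L TH4U (-(4 * (K : ℤ)))

/-- Upper bound of `M_top^{3q₃−2} = η^{2K}θ₃^{−3K}`. -/
def R8U (K : ℕ) : ℚ := powUp ETAL ETAU (2 * (K : ℤ)) * powUp TH3L TH3U (-(3 * (K : ℤ)))

/-- The objective scale `N_obj`. -/
def NOBJ : ℕ := 10 ^ 12

/-! ### Row kinds of template S -/

/-- `Σ₃(w) = Σ_{z ≠ w} (1[S_z] + 1[T_z])`. -/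
def sig3φ (w : ℕ) : DType → ℤ := fun τ =>
  (([1, 2, 3, 4].filter fun z => !(z == w)).map fun z => ind (τ.isS z) + ind (τ.isT z)).sum

/-- `1[S_z] + 1[T_z]`. -/
def stφ (z : ℕ) : DType → ℤ := fun τ => ind (τ.isS z) + ind (τ.isT z)

/-- Row kinds of the scaled programme (`w`, the bands and the world come from the case). -/
inductive SRow where
  /-- linear row `lin (linAll[i]) x̂ ≤ 0` -/
  | lin (i : ℕ)
  /-- `−Ê ≤ 0` -/
  | erow
  /-- dominance `T̂_z − T̂_w ≤ 0` -/
  | dom (z : ℕ)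
  /-- upper band `den·Ŝ_z − num·T̂_z ≤ 0`, `num/den = 1 + r_hi(z)` -/
  | bandhi (z : ℕ)
  /-- lower band `num·T̂_z − den·Ŝ_z ≤ 0`, `num/den = 1 + r_lo(z)` -/
  | bandlo (z : ℕ)
  /-- junk row with the `E` term: `Ŝ_z − T̂_z + Ê − ĵ_z ≤ 0` -/
  | junkE (z : ℕ)
  /-- junk row without the `E` term -/
  | junk0 (z : ℕ)
  /-- control row `x̂(CTRL_z) − T̂_z + Ê ≤ 0` -/
  | ctrlE (z : ℕ)
  /-- control row without the `E` term -/
  | ctrl0 (z : ℕ)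
  /-- relay-root consequence `den·P̂_{zy} − num·Ĉ_{zy} ≤ 0`, `num/den = 1 + r_hi(z)` -/
  | relay (z y : ℕ)
  /-- a template-B tangent row at grid index `K` -/
  | tan (r : TRow)
  /-- sqrt-STAR cut `N·T̂_z − G·Σ̂₄ ≤ H` with `θ = 2^{-t}`, support point `2^{i/32}` -/
  | star (z t : ℕ) (i : ℤ) (N G : ℕ) (H : ℚ)
  /-- STAR-B cut `N·T̂_z − G·Σ̂₃(w) ≤ H` with `θ = 2^{-t}`, support point `2^{i/32}` -/
  | starB (z t : ℕ) (i : ℤ) (N G : ℕ) (H : ℚ)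
  /-- box row `x̂_τ ≤ B` for the type of index `n` -/
  | box (n : ℕ) (B : ℚ)

/-- The type of index `n` in the table (default `K4`'s neighbour for out-of-range indices; never used). -/
def typeAt (n : ℕ) : DType := allTypes.getD n ⟨0, 0, 0, false, false, false, false⟩

/-- `(1 + h)` as `num, den`. -/
def onePlusND (h : ℚ) : ℤ × ℤ := ((1 + h).num, ((1 + h).den : ℤ))

/-- The LP row of a row kind in case `cs`. -/
def SRow.toRow (cs : SCase) : SRow → Row
  | .lin i => ⟨linAll.getD i (fun _ => 0), 0⟩
  | .erow => ⟨fun τ => -τ.eZ, 0⟩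
  | .dom z => ⟨combo [(1, fun τ => ind (τ.isT z)), (-1, fun τ => ind (τ.isT cs.w))], 0⟩
  | .bandhi z =>
    match (cs.bandOf z).hi with
    | some h => ⟨combo [((onePlusND h).2, fun τ => ind (τ.isS z)), (-(onePlusND h).1, fun τ => ind (τ.isT z))], 0⟩
    | none => ⟨fun _ => 0, 0⟩
  | .bandlo z => ⟨combo [((onePlusND (cs.bandOf z).lo).1, fun τ => ind (τ.isT z)),
      (-(onePlusND (cs.bandOf z).lo).2, fun τ => ind (τ.isS z))], 0⟩
  | .junkE z => ⟨combo [(1, fun τ => ind (τ.isS z)), (-1, fun τ => ind (τ.isT z)), (1, eZ), (-1, fun τ => ind (τ.junk z))], 0⟩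
  | .junk0 z => ⟨combo [(1, fun τ => ind (τ.isS z)), (-1, fun τ => ind (τ.isT z)), (-1, fun τ => ind (τ.junk z))], 0⟩
  | .ctrlE z => ⟨combo [(1, fun τ => ind (τ.ctrl z)), (-1, fun τ => ind (τ.isT z)), (1, eZ)], 0⟩
  | .ctrl0 z => ⟨combo [(1, fun τ => ind (τ.ctrl z)), (-1, fun τ => ind (τ.isT z))], 0⟩
  | .relay z y =>
    match (cs.bandOf z).hi with
    | some h => ⟨combo [((onePlusND h).2, fun τ => ind (τ.isP z y)), (-(onePlusND h).1, fun τ => ind (τ.isC z y))], 0⟩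
    | none => ⟨fun _ => 0, 0⟩
  | .tan r => r.toRow
  | .star z _ _ N G H => ⟨combo [((N : ℤ), fun τ => ind (τ.isT z)), (-(G : ℤ), sig4φ)], H⟩
  | .starB z _ _ N G H => ⟨combo [((N : ℤ), fun τ => ind (τ.isT z)), (-(G : ℤ), sig3φ cs.w)], H⟩
  | .box n B => ⟨fun τ => if τ = typeAt n then 1 else 0, B⟩

/-- Restriction check of world B: the functional is `≥ 0` on `LARGE_w` (dropping those coordinates keeps `≤`). -/
def restrOK (restricted : Bool) (w : ℕ) (φ : DType → ℤ) : Bool :=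
  !restricted || allTypes.all fun τ => !τ.large w || decide (0 ≤ φ τ)

/-- Support check of world B for a tangent row: both support functionals vanish on `LARGE_w`. -/
def suppOK (restricted : Bool) (w : ℕ) (r : TRow) : Bool :=
  !restricted || allTypes.all fun τ => !τ.large w || (r.kind.s1φ τ == 0 && r.kind.s2φ τ == 0)

/-- A `θ`-code `t` is admissible for the STAR rows of relay `z` in case `cs` (`2^{-t} ≤ θ_z`), resp. for the STAR-B rows
(`2^{-t} ≤ max(θ_w, θ_z)`). -/
def tcodeLE (oc : Option ℕ) (t : ℕ) : Bool := match oc with | some c => decide (c ≤ t) | none => false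

/-- **Row validity check** for case `cs`, world flag `restricted`, grid index `K`. -/
def SRow.ok (K : ℕ) (cs : SCase) (restricted : Bool) (r : SRow) : Bool :=
  let R4 : List ℕ := [1, 2, 3, 4]
  match r with
  | .lin i => decide (i < 49) && restrOK restricted cs.w (r.toRow cs).φ
  | .erow => restrOK restricted cs.w (r.toRow cs).φ
  | .dom z => decide (z ∈ R4) && !(z == cs.w) && decide (cs.w ∈ R4) && restrOK restricted cs.w (r.toRow cs).φ
  | .bandhi z => decide (z ∈ R4) && (cs.bandOf z).hi.isSome && restrOK restricted cs.w (r.toRow cs).φ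
  | .bandlo z => decide (z ∈ R4) && restrOK restricted cs.w (r.toRow cs).φ
  | .junkE z => decide (z ∈ R4) && restrOK restricted cs.w (r.toRow cs).φ
  | .junk0 z => decide (z ∈ R4) && restrOK restricted cs.w (r.toRow cs).φ
  | .ctrlE z => decide (z ∈ R4) && restrOK restricted cs.w (r.toRow cs).φ
  | .ctrl0 z => decide (z ∈ R4) && restrOK restricted cs.w (r.toRow cs).φ
  | .relay z y => decide (z ∈ R4) && decide (y ∈ R4) && !(z == y) && (cs.bandOf z).hi.isSome &&
      restrOK restricted cs.w (r.toRow cs).φ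
  | .tan tr => tr.ok K && suppOK restricted cs.w tr
  | .star z t i N G H => !restricted && decide (z ∈ R4) && !(z == cs.w) && decide (cs.w ∈ R4) && decide (K % 2 = 0) &&
      tcodeLE (cs.bandOf z).tcode t && decide (0 < N) &&
      decide (CuS K t * powUp TH4L TH4U (2 * i) * (1 - 2 * QL4) ≤ H / N) &&
      decide (CuS K t * (2 * QU4) * powUp TH4L TH4U (2 * i) * powUp ETAL ETAU (-i) ≤ (G : ℚ) / N)
  | .starB z t i N G H => decide (z ∈ R4) && !(z == cs.w) && decide (cs.w ∈ R4) && decide (K = 240) &&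
      (tcodeLE (cs.bandOf z).tcode t || tcodeLE (cs.bandOf cs.w).tcode t) && decide (0 < N) &&
      (match (cs.bandOf cs.w).hi with
        | some h =>
          (match CBU240 h t with
            | some cb => decide (cb * powUp ZL ZU i * (1 - EBL) ≤ H / N) &&
                decide (cb * EBU * powUp ZL ZU i * powUp ETAL ETAU (-i) ≤ (G : ℚ) / N)
            | none => false)
        | none => false)
  | .box n _ => decide (n < 94) && pcol restricted cs.w (typeAt n)

/-! ### Objectives, certificates, the checks -/

/-- The world of a certificate: A (all types; objective `GM4`), B (restricted to `SMALL_w`; objective `GM3` over `z ≠ w`),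
TOP (all types; objective `(ρ̂_aρ̂_bρ̂_c)^{1/3}` of the relay triple `S`). -/
inductive SWorld where
  /-- world A (and A+): unrestricted, objective `GM4` -/
  | A
  /-- world B: restricted variables, objective `GM3` -/
  | B
  /-- all-top objective: the geometric mean of the supports of the relay triple `S` -/
  | top (S : List ℕ)
deriving DecidableEq

/-- `restricted` flag of a world. -/
def SWorld.restricted : SWorld → Bool
  | .B => true
  | _ => false

/-- The three relays other than `w`, in increasing order. -/
def othersOf : ℕ → List ℕ
  | 1 => [2, 3, 4]
  | 2 => [1, 3, 4]
  | 3 => [1, 2, 4]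
  | _ => [1, 2, 3]

/-- The index list of the degree-1 objective's factors in world `W`, case `cs`. -/
def SWorld.zs (cs : SCase) : SWorld → List ℕ
  | .A => [1, 2, 3, 4]
  | .B => othersOf cs.w
  | .top S => S

/-- The number of factors of the objective (4 in world A, 3 in world B and all-top). -/
def SWorld.nfac : SWorld → ℕ
  | .A => 4
  | _ => 3

/-- The factor functionals of the objective: `Ŝ_z + T̂_z` (worlds A, B) or `ρ̂_t^S` (TOP). -/
def SWorld.facφ : SWorld → ℕ → DType → ℤ
  | .A => fun z τ => stφ z τ
  | .B => fun z τ => stφ z τ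
  | .top S => fun t τ => ind (τ.rho S t)

/-- A degree-1 objective as an integer functional: coefficients `gs` on the factors, plus `E1` on every `P`-column. -/
structure SObj where
  /-- integer tangent coefficients of the factors (scale `NOBJ`) -/
  gs : List ℕ
  /-- the `ε`-coefficient on the box columns (scale `NOBJ`) -/
  E1 : ℕ

/-- The objective functional `c = Σ_k gs[k]·fac_k + E1·1_P`. -/
def SObj.φ (cs : SCase) (W : SWorld) (o : SObj) : DType → ℤ := fun τ =>
  (((W.zs cs).zip o.gs).map fun p => (p.2 : ℤ) * W.facφ p.1 τ).sum +
    (if pcol W.restricted cs.w τ then (o.E1 : ℤ) else 0)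

/-- The AM–GM domination check of the objective: `Π_k (n·g_k) ≥ NOBJ^n` (`n` factors), so that the geometric mean of the
factors is `≤ (Σ_k g_k·fac_k)/NOBJ`; and `E1 ≥ 1`. -/
def SObj.ok (W : SWorld) (o : SObj) : Bool :=
  decide (o.gs.length = W.nfac) && decide (1 ≤ o.E1) && decide ((NOBJ : ℕ) ^ W.nfac ≤ (o.gs.map fun g => W.nfac * g).prod)

/-- A template-S certificate: rows, multipliers, objective, the box and the value. -/
structure SCert where
  /-- the rows -/
  rows : List SRow
  /-- the multipliers -/
  y : List ℚ
  /-- the objective -/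
  obj : SObj
  /-- the box of the box rows -/
  BOX : ℚ
  /-- the certified value of `lin c x̂` -/
  V : ℚ

/-- **The cone certificate check** (exact dual feasibility, NO variable bounds): as many multipliers as rows, `y ≥ 0`,
residual `c_τ − Σ_i y_iφ_i(τ) ≤ 0` on every type of the support `vs`, and `Σ_i y_ib_i ≤ V`. -/
def checkCone (vs : DType → Bool) (c : DType → ℤ) (rows : List Row) (y : List ℚ) (V : ℚ) : Bool :=
  decide (rows.length = y.length) && y.all (fun yi => decide (0 ≤ yi)) &&
    allTypes.all (fun τ => !vs τ || decide (resid (fun σ => (c σ : ℚ)) rows y τ ≤ 0)) &&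
    decide (dualValue rows y ≤ V)

/-- World admissibility for the case: world A needs a relay with `r_hi ≤ 1` (for `E ≤ U₄/3`), world B needs `θ_w > 0`,
TOP needs `S ∈ {123, 124}`; `w` must be a relay. -/
def SWorld.ok (cs : SCase) : SWorld → Bool
  | .A => decide (cs.w ∈ [1, 2, 3, 4]) && [1, 2, 3, 4].any fun z => match (cs.bandOf z).hi with | some h => decide (h ≤ 1) | none => false
  | .B => decide (cs.w ∈ [1, 2, 3, 4]) && (cs.bandOf cs.w).tcode.isSome
  | .top S => decide (cs.w ∈ [1, 2, 3, 4]) && decide (S = [1, 2, 3] ∨ S = [1, 2, 4])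

/-- All box rows carry the certificate's box. -/
def SRow.boxIs (B : ℚ) : SRow → Bool
  | .box _ B' => decide (B' = B)
  | _ => true

/-- **The programme check of template S** for case `cs`, world `W`, grid index `K`. -/
def checkS (K : ℕ) (cs : SCase) (W : SWorld) (c : SCert) : Bool :=
  W.ok cs && c.rows.all (SRow.ok K cs W.restricted) && c.obj.ok W && c.rows.all (SRow.boxIs c.BOX) &&
    decide (0 < c.BOX) && decide (0 ≤ c.V) && decide (c.V < c.obj.E1 * c.BOX) &&
    checkCone (vset W.restricted cs.w) (c.obj.φ cs W) (c.rows.map (SRow.toRow cs)) c.y c.V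

/-- Closing check of world A: `W = V/NOBJ ≤ 1` and `(RAU/3)^8·W^{13} ≤ 1` (⟹ `(1/3)M_top^{κ₀−1}W^{4p} ≤ 1` since `13/8 ≤ 4p`). -/
def closeA (K : ℕ) (V : ℚ) : Bool :=
  decide (V / NOBJ ≤ 1) && decide ((RAU K / 3) ^ 8 * (V / NOBJ) ^ 13 ≤ 1)

/-- Closing check of world B: `W ≤ 1` and `(RAU·CWU(r_hi(w))/3)^5·W^6 ≤ 1` (⟹ `(1/3)c_wM_top^{κ₀−1}W^{3p} ≤ 1`, `6/5 ≤ 3p`). -/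
def closeB (K : ℕ) (h : ℚ) (V : ℚ) : Bool :=
  match CWU h with
  | some cw => decide (V / NOBJ ≤ 1) && decide ((RAU K * cw / 3) ^ 5 * (V / NOBJ) ^ 6 ≤ 1)
  | none => false

/-- Closing check of the all-top (EIGHTH) bound: `W_S ≤ 1`, `W_S^{19} ≤ Y_S^{15}` (⟹ `W_S^{3q₃} ≤ Y_S`, `19/15 ≤ 3q₃`) and
`R8U·(Y₁ + Y₂) ≤ 8` (⟹ `(1/8)M_top^{3q₃−2}(W₁^{3q₃} + W₂^{3q₃}) ≤ 1`). -/
def close8 (K : ℕ) (V1 V2 Y1 Y2 : ℚ) : Bool :=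
  decide (V1 / NOBJ ≤ 1) && decide (V2 / NOBJ ≤ 1) && decide (0 ≤ Y1) && decide (0 ≤ Y2) &&
    decide ((V1 / NOBJ) ^ 19 ≤ Y1 ^ 15) && decide ((V2 / NOBJ) ^ 19 ≤ Y2 ^ 15) && decide (R8U K * (Y1 + Y2) ≤ 8)

/-- A case entry: a world-A certificate, a world-B certificate, or the all-top pair with its two root witnesses. -/
inductive CEntry where
  /-- world A / A+ -/
  | a (c : SCert)
  /-- world B -/
  | b (c : SCert)
  /-- all-top: certificates for the triples `123` and `124` and rational `Y_S ≥ W_S^{3q₃}` -/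
  | top (c1 c2 : SCert) (Y1 Y2 : ℚ)

/-- **THE CASE CHECK**: the certificate(s) pass `checkS` and the closing check of their world. -/
def caseCheck (K w : ℕ) (pat : List ℕ) : CEntry → Bool
  | .a c => checkS K ⟨w, pat⟩ .A c && closeA K c.V
  | .b c => checkS K ⟨w, pat⟩ .B c &&
      (match (band (pat.getD (w - 1) 2)).hi with | some h => closeB K h c.V | none => false)
  | .top c1 c2 Y1 Y2 => checkS K ⟨w, pat⟩ (.top [1, 2, 3]) c1 && checkS K ⟨w, pat⟩ (.top [1, 2, 4]) c2 &&
      close8 K c1.V c2.V Y1 Y2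

/-! ### Smoke tests of the data path -/

/-- `linAll` has 49 rows, `LARGE_w` has 7 types for every relay, and the `P`-columns number 78 (world A) / 71 (world B). -/
theorem scaled_table_smoke : linAll.length = 49 ∧ (∀ w ∈ [1, 2, 3, 4], (allTypes.filter fun τ => τ.large w).length = 7) ∧
    (allTypes.filter fun τ => pcol false 1 τ).length = 78 ∧
    (∀ w ∈ [1, 2, 3, 4], (allTypes.filter fun τ => pcol true w τ).length = 71) := by
  decide +kernel

/-- A sqrt-STAR cut (`z = 2`, `θ = 1/2`, support `2^{-100/32}`) and a STAR-B cut as emitted by the lane's generator pass the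
checks in case `w = 1`, pattern `[1,0,0,0]`, world A. -/
theorem srow_ok_smoke :
    SRow.ok 240 ⟨1, [1, 0, 0, 0]⟩ false (.star 2 1 (-100) (10 ^ 9) 109036195 (2858537219352379 / 1000000000)) = true ∧
    SRow.ok 240 ⟨1, [1, 0, 0, 0]⟩ false (.starB 2 1 (-100) (10 ^ 9) 144492306 (63134484139471 / 12500000)) = true := by
  decide +kernel

end TypeTable
end HubOnly

end Summit.CriticalPhenomena.PercolationContinuityZ3.Theorems
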